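import Mathlib.Combinatorics.SimpleGraph.Walk.Counting
import Mathlib.Combinatorics.SimpleGraph.Paths
import Mathlib.Combinatorics.SimpleGraph.DeleteEdges
import Mathlib.Topology.Algebra.InfiniteSum.ENNReal
import Summits.CriticalPhenomena.SAWScalingLimit.Theorems.SAWTotalPositivityBoundaryTP2Defs
import Summits.CriticalPhenomena.SAWScalingLimit.Theorems.SAWTotalPositivityBoundaryTP2Kernel
import Summits.CriticalPhenomena.SAWScalingLimit.Theorems.SAWTotalPositivityBoundaryTP2Symmetry
import Summits.CriticalPhenomena.SAWScalingLimit.Theorems.SAWTotalPositivityBoundaryTP2CutVertex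
import Summits.CriticalPhenomena.SAWScalingLimit.Theorems.SAWLeftRightFKGLeftRightFKGInterlacedOfGraphTP2
import HarnessLib

/-!
# Brackets of the Menger decomposition from gadgets at the marked points — crux `LeftRightFKG`
(stmt-CriticalPhenomena-11232), line `corner-localisation`, lead c3 (skeleton v8)

Lead c2 decomposed an interlaced, pairwise distinct corner quadruple `(u, w, w', u')` of a finite `H ≤ ℤ²` that is not
disjointly realisable in the pairing `(u u' | w w')` along a one-vertex cut `z` between `{u, w}` and `{w', u'}`
(`ThreePoint.exists_cut_sets`, `BoundaryTP2.stub_cutVertex_factor`): the TP₂ inequality becomes the product of the two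
BRACKETS `Z_A(u,z) Z_A(w,z) ≤ Z_H(u,w)` and `Z_B(z,w') Z_B(z,u') ≤ Z_H(w',u')`, which c2 closed with a general three-point
hypothesis. In a CORNER quadruple the points `u, u'` are lattice neighbours of an isolated vertex `p` and `w, w'` of an
isolated vertex `q`, and lead c3's gadgets at `p`, `q` supply the brackets from `GraphTP2At x` alone. This helper file
does the case analysis of ONE bracket (`bracket_of_gadgets`), given the two gadget statements as hypotheses (they are
the registered stubs `stub_chainGadget` — conclusion `hGL` — and `stub_blobGadget` — conclusion `hBG` — of the line):

* `z = u` or `z = w`: `Z(z,z) = 1` and monotonicity of the kernel in the graph;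
* `u, w` not connected in `H − z`: `z` also separates `u` from `w`, and a second cut-vertex factorisation gives the
  bracket as an (in)equality (`bracket_of_not_reachable_deleteVert`);
* `w, z` connected in `H − u`: the blob gadget through `p` (hang `u–p–u'`), or, when the cut vertex is `u'` itself,
  the chain gadget `u'–p–u`;
* else `u, z` connected in `H − w`: the mirror gadgets through `q`;
* else `w` does not reach `z` at all (`not_reachable_of_two_separations`) and the bracket is `0 ≤ ·`.

Everything here is proved; Mathlib and the landed toolkit (`BoundaryTP2.{Kernel, Symmetry, CutVertex}`,
`ThreePoint.exists_cut_sets`) only. [folklore]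
-/

noncomputable section

open Literature.Probability.LatticeModels
open Summit.CriticalPhenomena.SAWScalingLimit.Theorems.BoundaryTP2
open scoped ENNReal

namespace Summit.CriticalPhenomena.SAWScalingLimit.Theorems.LeftRightFKG.CornerGadget

variable {V : Type*}

/-! ## Walks avoiding a vertex -/

/-- A walk of `H` avoiding the vertex `c` is a walk of the vertex-deleted graph `H - c`, so its endpoints are
connected there. [folklore] -/
theorem reachable_deleteVert_of_walk {H : SimpleGraph V} {c u v : V} (p : H.Walk u v) (hc : c ∉ p.support) :
    (H.deleteEdges (H.incidenceSet c)).Reachable u v := by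
  refine ⟨p.transfer _ fun e he => ?_⟩
  rw [SimpleGraph.edgeSet_deleteEdges]
  exact ⟨p.edges_subset_edgeSet he, fun hinc => hc (SimpleGraph.Walk.mem_support_of_mem_edges he hinc.2)⟩

/-- If `u` and `v` are not connected in `H - c`, every walk `u → v` of `H` visits `c`. [folklore] -/
theorem mem_support_of_not_reachable_deleteVert {H : SimpleGraph V} {c u v : V}
    (h : ¬ (H.deleteEdges (H.incidenceSet c)).Reachable u v) (p : H.Walk u v) : c ∈ p.support := by
  by_contra hc
  exact h (reachable_deleteVert_of_walk p hc)

/-- The initial vertex of a self-avoiding path does not lie on the part of the path after a later vertex `w ≠ u`.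
[folklore] -/
theorem start_not_mem_support_dropUntil [DecidableEq V] {H : SimpleGraph V} {u v w : V} (p : H.Walk u v)
    (hp : p.IsPath)
    (hw : w ∈ p.support) (huw : u ≠ w) : u ∉ (p.dropUntil w hw).support := by
  intro hu
  have hnd : ((p.takeUntil w hw).append (p.dropUntil w hw)).support.Nodup := by
    rw [p.take_spec hw]; exact hp.support_nodup
  rw [SimpleGraph.Walk.support_append] at hnd
  have hu' : u ∈ (p.dropUntil w hw).support.tail := by
    rw [← SimpleGraph.Walk.cons_tail_support] at hu
    rcases List.mem_cons.1 hu with h | h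
    · exact absurd h huw
    · exact h
  exact List.disjoint_of_nodup_append hnd (SimpleGraph.Walk.start_mem_support _) hu'

/-- If `u` separates `w` from `z` and `w` separates `u` from `z` (with `u ≠ w`), then `w` does not reach `z` at all:
a path `w → z` would visit `u`, and its part after `u` avoids `w`. [folklore] -/
theorem not_reachable_of_two_separations {H : SimpleGraph V} {u w z : V} (huw : u ≠ w)
    (h₁ : ¬ (H.deleteEdges (H.incidenceSet u)).Reachable w z)
    (h₂ : ¬ (H.deleteEdges (H.incidenceSet w)).Reachable u z) : ¬ H.Reachable w z := by
  classical
  rintro ⟨q⟩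
  have hu : u ∈ (q.toPath : H.Walk w z).support := mem_support_of_not_reachable_deleteVert h₁ _
  have hw : w ∉ ((q.toPath : H.Walk w z).dropUntil u hu).support :=
    start_not_mem_support_dropUntil _ q.toPath.2 hu huw.symm
  exact h₂ (reachable_deleteVert_of_walk _ hw)

/-! ## The degenerate bracket: a second cut at `z` -/

/-- If `u` and `w` are not connected in `H - z`, then `z` separates them and the cut-vertex factorisation through `z`
gives `Z_K(u,z) Z_K(w,z) ≤ Z_H(u,w)` for every subgraph `K ≤ H` (an equality for `K = H`). [folklore] -/
theorem bracket_of_not_reachable_deleteVert {H K : SimpleGraph V} (hK : K ≤ H) (x : ℝ) (hx : 0 ≤ x) {u w z : V}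
    (h : ¬ (H.deleteEdges (H.incidenceSet z)).Reachable u w) :
    pathKernel K x u z * pathKernel K x w z ≤ pathKernel H x u w := by
  have hz : ∀ (s t : V) (q : H.Walk s t), s ∈ ({s | s = u} : Set V) → t ∈ ({t | t = w} : Set V) →
      z ∈ q.support := by
    rintro s t q hs ht
    rw [Set.mem_setOf_eq] at hs ht
    subst hs; subst ht
    exact mem_support_of_not_reachable_deleteVert h q
  obtain ⟨A, B, hAB, hc, hzA, hzB, hsep, hS, hT⟩ := ThreePoint.exists_cut_sets H _ _ z hz
  have huA : u ∈ A := hS u rfl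
  have hwB : w ∈ B := hT w rfl
  rw [stub_cutVertex_factor H x hx A B z u w hAB hc hzA hzB hsep huA hwB]
  refine mul_le_mul' ?_ ?_
  · calc pathKernel K x u z ≤ pathKernel H x u z := pathKernel_mono hK x u z
      _ = _ := by
        rw [stub_cutVertex_factor H x hx A B z u z hAB hc hzA hzB hsep huA hzB, pathKernel_self, mul_one]
  · calc pathKernel K x w z ≤ pathKernel H x w z := pathKernel_mono hK x w z
      _ = pathKernel H x z w := pathKernel_comm _ _ _ _
      _ = _ := by
        rw [stub_cutVertex_factor H x hx A B z z w hAB hc hzA hzB hsep hzA hwB, pathKernel_self, one_mul]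

/-! ## One bracket from the gadgets at the two marked points -/

/-- **The bracket of the Menger decomposition, from the gadget statements.** Let `A, B, z` be cut data of a finite
`H ≤ ℤ²` (`V = A ∪ B`, `A ∩ B = {z}`, every edge inside `A` or inside `B`), `u ≠ w` in `A`, `u', w'` in `B∖{z}`,
`p` isolated and lattice-adjacent to `u` and `u'`, `q` isolated and lattice-adjacent to `w` and `w'`, and
`Z_H(z,u') ≠ 0 ≠ Z_H(z,w')`. If the chain-gadget statement `hGL` and the blob-gadget statement `hBG` hold at fugacity
`x ≥ 0`, then `Z_A(u,z) · Z_A(w,z) ≤ Z_H(u,w)` (`Z_A` the kernel of the `A`-piece). See the module docstring for the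
case analysis. [folklore] -/
theorem bracket_of_gadgets {x : ℝ} (hx : 0 ≤ x)
    (hGL : ∀ (H : SimpleGraph (Site 2)), H ≤ zdGraph 2 → H.support.Finite →
      ∀ c a b p : Site 2, c ≠ a → c ≠ b → a ≠ b → p ∉ H.support → (zdGraph 2).Adj c p → (zdGraph 2).Adj p b →
        (H.deleteEdges (H.incidenceSet c)).Reachable a b → (H.deleteEdges (H.incidenceSet b)).Reachable a c →
        pathKernel H x c a * pathKernel H x c b ≤ pathKernel H x a b)
    (hBG : ∀ (H : SimpleGraph (Site 2)), H ≤ zdGraph 2 → H.support.Finite →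
      ∀ (A B : Set (Site 2)) (z u w u' p : Site 2),
        (∀ v, v ∈ A ∨ v ∈ B) → (∀ v, v ∈ A → v ∈ B → v = z) → z ∈ A → z ∈ B →
        (∀ a b, H.Adj a b → (a ∈ A ∧ b ∈ A) ∨ (a ∈ B ∧ b ∈ B)) →
        u ∈ A → w ∈ A → u' ∈ B → z ≠ u → z ≠ w → z ≠ u' → u ≠ w →
        p ∉ H.support → (zdGraph 2).Adj u p → (zdGraph 2).Adj p u' →
        pathKernel H x z u' ≠ 0 →
        (H.deleteEdges (H.incidenceSet z)).Reachable u w → (H.deleteEdges (H.incidenceSet u)).Reachable w z →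
        pathKernel (SimpleGraph.fromRel fun a b => H.Adj a b ∧ a ∈ A ∧ b ∈ A) x u z *
          pathKernel (SimpleGraph.fromRel fun a b => H.Adj a b ∧ a ∈ A ∧ b ∈ A) x w z ≤ pathKernel H x u w)
    (H : SimpleGraph (Site 2)) (hH : H ≤ zdGraph 2) (hfin : H.support.Finite)
    {A B : Set (Site 2)} {z u w u' w' p q : Site 2}
    (hAB : ∀ v, v ∈ A ∨ v ∈ B) (hc : ∀ v, v ∈ A → v ∈ B → v = z) (hzA : z ∈ A) (hzB : z ∈ B)
    (hsep : ∀ a b, H.Adj a b → (a ∈ A ∧ b ∈ A) ∨ (a ∈ B ∧ b ∈ B))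
    (hu : u ∈ A) (hw : w ∈ A) (hu' : u' ∈ B) (hw' : w' ∈ B) (hzu' : z ≠ u') (hzw' : z ≠ w') (huw : u ≠ w)
    (hp : p ∉ H.support) (hpu : (zdGraph 2).Adj u p) (hpu' : (zdGraph 2).Adj p u')
    (hq : q ∉ H.support) (hqw : (zdGraph 2).Adj w q) (hqw' : (zdGraph 2).Adj q w')
    (hβu : pathKernel H x z u' ≠ 0) (hβw : pathKernel H x z w' ≠ 0) :
    pathKernel (SimpleGraph.fromRel fun a b => H.Adj a b ∧ a ∈ A ∧ b ∈ A) x u z *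
      pathKernel (SimpleGraph.fromRel fun a b => H.Adj a b ∧ a ∈ A ∧ b ∈ A) x w z ≤ pathKernel H x u w := by
  set GA := SimpleGraph.fromRel fun a b => H.Adj a b ∧ a ∈ A ∧ b ∈ A with hGA
  have hAle : GA ≤ H := ThreePoint.piece_le H A
  -- `z` is one of the two points: `Z(z,z) = 1`
  by_cases hzu : z = u
  · subst hzu
    rw [pathKernel_self, one_mul, pathKernel_comm H x z w]
    exact pathKernel_mono hAle x w z
  by_cases hzw : z = w
  · subst hzw
    rw [pathKernel_self, mul_one]
    exact pathKernel_mono hAle x u z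
  -- `z` separates `u` from `w`: second cut
  by_cases hR : (H.deleteEdges (H.incidenceSet z)).Reachable u w
  swap
  · exact bracket_of_not_reachable_deleteVert hAle x hx hR
  -- the gadgets through `p`
  by_cases hR₁ : (H.deleteEdges (H.incidenceSet u)).Reachable w z
  · by_cases hzu'e : z = u'
    · -- the cut vertex is `u'` itself: chain `u'–p–u`
      have key := hGL H hH hfin z w u p hzw hzu huw.symm hp (hzu'e ▸ hpu'.symm) hpu.symm hR.symm hR₁
      calc pathKernel GA x u z * pathKernel GA x w z
          ≤ pathKernel H x u z * pathKernel H x w z :=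
            mul_le_mul' (pathKernel_mono hAle x u z) (pathKernel_mono hAle x w z)
        _ = pathKernel H x z w * pathKernel H x z u := by
            rw [mul_comm, pathKernel_comm H x w z, pathKernel_comm H x u z]
        _ ≤ pathKernel H x w u := key
        _ = pathKernel H x u w := pathKernel_comm _ _ _ _
    · exact hBG H hH hfin A B z u w u' p hAB hc hzA hzB hsep hu hw hu' hzu hzw hzu' huw hp hpu hpu' hβu hR hR₁
  -- the gadgets through `q`
  by_cases hR₂ : (H.deleteEdges (H.incidenceSet w)).Reachable u z
  · by_cases hzw'e : z = w'
    · -- the cut vertex is `w'` itself: chain `w'–q–w`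
      have key := hGL H hH hfin z u w q hzu hzw huw hq (hzw'e ▸ hqw'.symm) hqw.symm hR hR₂
      calc pathKernel GA x u z * pathKernel GA x w z
          ≤ pathKernel H x u z * pathKernel H x w z :=
            mul_le_mul' (pathKernel_mono hAle x u z) (pathKernel_mono hAle x w z)
        _ = pathKernel H x z u * pathKernel H x z w := by
            rw [pathKernel_comm H x u z, pathKernel_comm H x w z]
        _ ≤ pathKernel H x u w := key
    · have key := hBG H hH hfin A B z w u w' q hAB hc hzA hzB hsep hw hu hw' hzw hzu hzw' (Ne.symm huw) hq hqw
        hqw' hβw hR.symm hR₂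
      rwa [mul_comm, pathKernel_comm H x w u] at key
  -- neither: `w` does not reach `z`
  · have h0 : pathKernel H x w z = 0 :=
      pathKernel_eq_zero_of_not_reachable H x (not_reachable_of_two_separations huw hR₁ hR₂)
    have h0' : pathKernel GA x w z = 0 := le_antisymm (h0 ▸ pathKernel_mono hAle x w z) zero_le
    rw [h0', mul_zero]
    exact zero_le

/-! ## The general bracket (cut vertex possibly a marked neighbour) -/

/-- **The bracket of the Menger decomposition, from the gadget statements — general form** (the cut vertex `z` may
coincide with `u'` or `w'`). Let `A, B, z` be cut data of a finite `H ≤ ℤ²`, `u ≠ w` in `A`, `u', w'` in `B`, `p`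
isolated and lattice-adjacent to `u` and `u'`, `q` isolated and lattice-adjacent to `w` and `w'`, and
`Z_H(z,u') ≠ 0 ≠ Z_H(z,w')`. If the chain-gadget statement `hGL` and the blob-gadget statement `hBG` hold at fugacity
`x ≥ 0`, then `Z_A(u,z) · Z_A(w,z) ≤ Z_H(u,w)`: as `bracket_of_gadgets`, the blob gadget through `p` (resp. `q`) being
replaced by the chain `u'–p–u` (resp. `w'–q–w`) exactly when `z = u'` (resp. `z = w'`). [folklore] -/
theorem bracket_of_gadgets' {x : ℝ} (hx : 0 ≤ x)
    (hGL : ∀ (H : SimpleGraph (Site 2)), H ≤ zdGraph 2 → H.support.Finite →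
      ∀ c a b p : Site 2, c ≠ a → c ≠ b → a ≠ b → p ∉ H.support → (zdGraph 2).Adj c p → (zdGraph 2).Adj p b →
        (H.deleteEdges (H.incidenceSet c)).Reachable a b → (H.deleteEdges (H.incidenceSet b)).Reachable a c →
        pathKernel H x c a * pathKernel H x c b ≤ pathKernel H x a b)
    (hBG : ∀ (H : SimpleGraph (Site 2)), H ≤ zdGraph 2 → H.support.Finite →
      ∀ (A B : Set (Site 2)) (z u w u' p : Site 2),
        (∀ v, v ∈ A ∨ v ∈ B) → (∀ v, v ∈ A → v ∈ B → v = z) → z ∈ A → z ∈ B →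
        (∀ a b, H.Adj a b → (a ∈ A ∧ b ∈ A) ∨ (a ∈ B ∧ b ∈ B)) →
        u ∈ A → w ∈ A → u' ∈ B → z ≠ u → z ≠ w → z ≠ u' → u ≠ w →
        p ∉ H.support → (zdGraph 2).Adj u p → (zdGraph 2).Adj p u' →
        pathKernel H x z u' ≠ 0 →
        (H.deleteEdges (H.incidenceSet z)).Reachable u w → (H.deleteEdges (H.incidenceSet u)).Reachable w z →
        pathKernel (SimpleGraph.fromRel fun a b => H.Adj a b ∧ a ∈ A ∧ b ∈ A) x u z *
          pathKernel (SimpleGraph.fromRel fun a b => H.Adj a b ∧ a ∈ A ∧ b ∈ A) x w z ≤ pathKernel H x u w)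
    (H : SimpleGraph (Site 2)) (hH : H ≤ zdGraph 2) (hfin : H.support.Finite)
    {A B : Set (Site 2)} {z u w u' w' p q : Site 2}
    (hAB : ∀ v, v ∈ A ∨ v ∈ B) (hc : ∀ v, v ∈ A → v ∈ B → v = z) (hzA : z ∈ A) (hzB : z ∈ B)
    (hsep : ∀ a b, H.Adj a b → (a ∈ A ∧ b ∈ A) ∨ (a ∈ B ∧ b ∈ B))
    (hu : u ∈ A) (hw : w ∈ A) (hu' : u' ∈ B) (hw' : w' ∈ B) (huw : u ≠ w)
    (hp : p ∉ H.support) (hpu : (zdGraph 2).Adj u p) (hpu' : (zdGraph 2).Adj p u')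
    (hq : q ∉ H.support) (hqw : (zdGraph 2).Adj w q) (hqw' : (zdGraph 2).Adj q w')
    (hβu : pathKernel H x z u' ≠ 0) (hβw : pathKernel H x z w' ≠ 0) :
    pathKernel (SimpleGraph.fromRel fun a b => H.Adj a b ∧ a ∈ A ∧ b ∈ A) x u z *
      pathKernel (SimpleGraph.fromRel fun a b => H.Adj a b ∧ a ∈ A ∧ b ∈ A) x w z ≤ pathKernel H x u w := by
  set GA := SimpleGraph.fromRel fun a b => H.Adj a b ∧ a ∈ A ∧ b ∈ A with hGA
  have hAle : GA ≤ H := ThreePoint.piece_le H A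
  -- `z` is one of the two points: `Z(z,z) = 1`
  by_cases hzu : z = u
  · subst hzu
    rw [pathKernel_self, one_mul, pathKernel_comm H x z w]
    exact pathKernel_mono hAle x w z
  by_cases hzw : z = w
  · subst hzw
    rw [pathKernel_self, mul_one]
    exact pathKernel_mono hAle x u z
  -- `z` separates `u` from `w`: second cut
  by_cases hR : (H.deleteEdges (H.incidenceSet z)).Reachable u w
  swap
  · exact bracket_of_not_reachable_deleteVert hAle x hx hR
  -- the gadgets through `p`
  by_cases hR₁ : (H.deleteEdges (H.incidenceSet u)).Reachable w z
  · by_cases hzu'e : z = u'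
    · -- the cut vertex is `u'` itself: chain `u'–p–u`
      have key := hGL H hH hfin z w u p hzw hzu huw.symm hp (hzu'e ▸ hpu'.symm) hpu.symm hR.symm hR₁
      calc pathKernel GA x u z * pathKernel GA x w z
          ≤ pathKernel H x u z * pathKernel H x w z :=
            mul_le_mul' (pathKernel_mono hAle x u z) (pathKernel_mono hAle x w z)
        _ = pathKernel H x z w * pathKernel H x z u := by
            rw [mul_comm, pathKernel_comm H x w z, pathKernel_comm H x u z]
        _ ≤ pathKernel H x w u := key
        _ = pathKernel H x u w := pathKernel_comm _ _ _ _
    · exact hBG H hH hfin A B z u w u' p hAB hc hzA hzB hsep hu hw hu' hzu hzw hzu'e huw hp hpu hpu' hβu hR hR₁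
  -- the gadgets through `q`
  by_cases hR₂ : (H.deleteEdges (H.incidenceSet w)).Reachable u z
  · by_cases hzw'e : z = w'
    · -- the cut vertex is `w'` itself: chain `w'–q–w`
      have key := hGL H hH hfin z u w q hzu hzw huw hq (hzw'e ▸ hqw'.symm) hqw.symm hR hR₂
      calc pathKernel GA x u z * pathKernel GA x w z
          ≤ pathKernel H x u z * pathKernel H x w z :=
            mul_le_mul' (pathKernel_mono hAle x u z) (pathKernel_mono hAle x w z)
        _ = pathKernel H x z u * pathKernel H x z w := by
            rw [pathKernel_comm H x u z, pathKernel_comm H x w z]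
        _ ≤ pathKernel H x u w := key
    · have key := hBG H hH hfin A B z w u w' q hAB hc hzA hzB hsep hw hu hw' hzw hzu hzw'e (Ne.symm huw) hq hqw
        hqw' hβw hR.symm hR₂
      rwa [mul_comm, pathKernel_comm H x w u] at key
  -- neither: `w` does not reach `z`
  · have h0 : pathKernel H x w z = 0 :=
      pathKernel_eq_zero_of_not_reachable H x (not_reachable_of_two_separations huw hR₁ hR₂)
    have h0' : pathKernel GA x w z = 0 := le_antisymm (h0 ▸ pathKernel_mono hAle x w z) zero_le
    rw [h0', mul_zero]
    exact zero_le

end Summit.CriticalPhenomena.SAWScalingLimit.Theorems.LeftRightFKG.CornerGadget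

end
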